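import Summits.BirchSwinnertonDyer.BirchSwinnertonDyer.Theorems.AlignedTransportAtTwoMainConjectureOfRankZeroBSDAtTwoSelmerLayerDescentMonotone
import Summits.BirchSwinnertonDyer.BirchSwinnertonDyer.Theorems.AlignedTransportAtTwoMainConjectureOfRankZeroBSDAtTwoSelmerLayerModelAtTwo
import Literature.NumberTheory.EllipticCurves.ZpCorankQuasiIso
import Literature.NumberTheory.EllipticCurves.SelmerCorankHolds
import HarnessLib

/-!
# Route `AlignedTransportAtTwo`, crux C2 `MainConjectureOfRankZeroBSDAtTwo` (stmt-BirchSwinnertonDyer-22298):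
# THE PRICE OF STATIONARITY — the `2`-descent over the first layer `ℚ(√2)` already sees the quadratic twist:
# `2^{corank Sel_{2^∞}(W/ℚ) + corank Sel_{2^∞}(W⁽²⁾/ℚ)} ≤ #Sel^(2)(E/ℚ_n)` for every layer `n ≥ 1`

HONEST FRAMING (cell `bsd-f1-sign2`, WIDTH-5 attached prover seat `bsd-line-att-p5` gen 45 on line `birth` of the lead
`bsd-line-att-p2`; `--supports` stmt-BirchSwinnertonDyer-22298, closes nothing; BSD is NOT proved by any of this; the crux C2,
its verdict «blocked-on `Rank1Residual.GreenbergMuConjectureIrreducible`» and every registered stub are untouched). THEOREMS ONLY —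
no `def`, no instance, no named fact, no `sorry`. PLACEMENT: COROLLARY-OF-TREE (g38/g39 `zpCorank_selmerLayer_one_eq_add` =
Dokchitser–Dokchitser Lemma 4.14 for `ℚ(√2)/ℚ` transported to the `Γ_ℚ`-internal layer; the corank formula
`pow_zpCorank_mul_natCard_modN`; this seat's monotonicity `…DescentMonotone`).

The stationarity door of `…DescentGrowthBudget` (`#Sel^(2)(E/ℚ(ζ₁₆)⁺) ≤ #Sel^(2)(E/ℚ)` ⟹ `TowerGapAtTwo W`) has a price that the
first layer alone displays: `ℚ_1 = ℚ(√2)`, and the `2^∞`-Selmer corank over `ℚ(√2)` is the sum of the coranks of `W` and of its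
quadratic twist `W⁽²⁾` over `ℚ`. Hence:

* ★ `two_pow_selmerCorank_add_twist_le_natCard_selmerGroup_layer` — **`2^{corank_{ℤ₂} Sel_{2^∞}(W/ℚ) + corank_{ℤ₂} Sel_{2^∞}(W⁽²⁾/ℚ)}
  ≤ #Sel^(2)(E/ℚ_n)`** for every `n ≥ 1`, every cyclotomic `κ`, every cell curve (no rational `2`-torsion abscissa);
* ★ `two_pow_rank_add_rank_twist_le_natCard_selmerGroup_layer` — in Mordell–Weil currency **`2^{rank W(ℚ) + rank W⁽²⁾(ℚ)} ≤ #Sel^(2)(E/ℚ_n)`**;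
* ★★ `selmerCorank_add_twist_le_of_stationary` — **if the `2`-Selmer group does not grow from `ℚ` to some layer `n ≥ 1` then
  `2^{corank Sel_{2^∞}(W/ℚ) + corank Sel_{2^∞}(W⁽²⁾/ℚ)} ≤ #Sel^(2)(E/ℚ)`**; in rank `0` the right side is `#Ш(E/ℚ)[2]`
  (`…_le_natCard_sha_of_stationary`), and ★★ `selmerCorank_twist_eq_zero_of_stationary_of_natCard_selmerGroup_eq_one`: **on a seed with
  `Sel^(2)(E/ℚ) = 0` stationarity at ANY layer `n ≥ 1` forces `Sel_{2^∞}(W⁽²⁾/ℚ)` (and `Sel_{2^∞}(W/ℚ)`) to have corank `0`** — so the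
  ℚ(ζ₁₆)⁺ door is aimed at seeds whose `ℚ(√2)`-twist has `2^∞`-Selmer corank `0` (by `2`-parity, Monsky 1996 / Dokchitser–Dokchitser,
  and `w(W⁽²⁾) = (2/N)` for odd `N`, this excludes `N ≡ ±3 (mod 8)` — a PRINT remark, not used here); elsewhere the growth-budget door
  at `ℚ(ζ₃₂)⁺` must absorb the twist's corank.

References: T. Dokchitser, V. Dokchitser, Ann. of Math. 172 (2010), Lemma 4.14 [DokchitserDokchitserAnnals2010]; R. Greenberg, LNM 1716
(1999), §1–§3 [GreenbergLNM1716]; J. H. Silverman, GTM 106, Thm. X.4.2 [SilvermanAEC2009]; L. C. Washington, GTM 83, §13.1 [Washington1997].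
-/

set_option linter.dupNamespace false
set_option autoImplicit false

noncomputable section

open scoped Classical AddSubgroup

namespace Summit.BirchSwinnertonDyer.BirchSwinnertonDyer.Theorems.AlignedTransportAtTwoSelmerLayerDescentTwistObstruction

open WeierstrassCurve Literature.NumberTheory.EllipticCurves Literature.NumberTheory.EllipticCurves.Greenberg1999
  Summit.BirchSwinnertonDyer.BirchSwinnertonDyer.Theorems.AlignedTransportAtTwoSelmerLayerModel
  Summit.BirchSwinnertonDyer.BirchSwinnertonDyer.Theorems.AlignedTransportAtTwoSelmerLayerModelAtTwo
  Summit.BirchSwinnertonDyer.BirchSwinnertonDyer.Theorems.AlignedTransportAtTwoSelmerLayerMuDoorDescent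
  Summit.BirchSwinnertonDyer.BirchSwinnertonDyer.Theorems.AlignedTransportAtTwoSelmerLayerMuDoorDescentBase
  Summit.BirchSwinnertonDyer.BirchSwinnertonDyer.Theorems.AlignedTransportAtTwoSelmerLayerDescentMonotone

variable (W : WeierstrassCurve ℚ) [W.IsElliptic] [W.IsGloballyMinimal]

omit [W.IsGloballyMinimal] in
/-- `2^{corank_{ℤ₂} (W.selmerLayer κ n)} ≤ #(W.selmerLayer κ n)[2]`: the corank formula `#A[p] = p^{corank A} · #(A/pA)` for the
`2`-primary group `A = W.selmerLayer κ n` with finite `2`-torsion (tree `pow_zpCorank_mul_natCard_modN`, `finite_modN_of_primary`).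
[cite: GreenbergLNM1716, §1 p. 53 («cofinitely generated»)] -/
theorem two_pow_zpCorank_selmerLayer_le_natCard_torsionBy (κ : ZpExtension ℚ 2) (n : ℕ) :
    2 ^ zpCorank (W.selmerLayer κ n) 2 ≤ Nat.card ((↥(W.selmerLayer κ n))[((2 : ℕ) : ℤ)]) := by
  haveI : Finite ((↥(W.selmerLayer κ n))[((2 : ℕ) : ℤ)]) :=
    W.finite_torsionBy_selmerGroupOver 2 (κ.layerSubgroup n) (κ.isOpen_layerSubgroup n)
  have hA : ∀ s : W.selmerLayer κ n, ∃ k : ℕ, 2 ^ k • s = 0 := fun s ↦ exists_pow_smul_selmerLayer_eq_zero W κ n s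
  have hmod := (finite_modN_of_primary (p := 2) hA).1
  haveI := hmod
  have hpos : 0 < Nat.card (ModN (↥(W.selmerLayer κ n)) 2) := Nat.card_pos
  have h := pow_zpCorank_mul_natCard_modN (p := 2) hA
  calc 2 ^ zpCorank (W.selmerLayer κ n) 2 ≤ 2 ^ zpCorank (W.selmerLayer κ n) 2 * Nat.card (ModN (↥(W.selmerLayer κ n)) 2) :=
      Nat.le_mul_of_pos_right _ hpos
    _ = Nat.card ((↥(W.selmerLayer κ n))[((2 : ℕ) : ℤ)]) := h

omit [W.IsGloballyMinimal] in
/-- ★ **THE FIRST LAYER SEES THE TWIST: `2^{corank Sel_{2^∞}(W/ℚ) + corank Sel_{2^∞}(W⁽²⁾/ℚ)} ≤ #Sel^(2)(E/ℚ_n)` for every `n ≥ 1`**, every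
cyclotomic `κ`, and every `W/ℚ` (globally minimal not needed, elliptic) without a rational `2`-torsion abscissa: `ℚ_1 = ℚ(√2)` and
`corank (W.selmerLayer κ 1) = corank Sel_{2^∞}(W/ℚ) + corank Sel_{2^∞}(W⁽²⁾/ℚ)` (g38/g39, Dokchitser–Dokchitser L. 4.14), the corank is
at most `log₂ #(·)[2]`, the layer-`1` count is `#Sel^(2)(E/ℚ_1)` (g44) and the counts only grow (`…DescentMonotone`).
[cite: DokchitserDokchitserAnnals2010, Lemma 4.14] [cite: GreenbergLNM1716, §3 Lemma 3.1] [cite: SilvermanAEC2009, Thm. X.4.2] -/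
theorem two_pow_selmerCorank_add_twist_le_natCard_selmerGroup_layer (ht : ∀ x : ℚ, ¬ HasRationalTwoTorsionX W x)
    {κ : ZpExtension ℚ 2} (hκ : κ.IsCyclotomic) {n : ℕ} (hn : 1 ≤ n) :
    2 ^ (W.selmerCorank 2 + (W.quadraticTwist 2).selmerCorank 2) ≤ Nat.card ((W.baseChange (κ.layer n)).selmerGroup 2) := by
  rw [← zpCorank_selmerLayer_one_eq_add W hκ]
  have h1 := two_pow_zpCorank_selmerLayer_le_natCard_torsionBy W κ 1
  have h2 : Nat.card ((↥(W.selmerLayer κ 1))[((2 : ℕ) : ℤ)]) = Nat.card ((W.baseChange (κ.layer 1)).selmerGroup 2) := by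
    rw [natCard_selmerGroup_two_layer_eq W ht κ 1]; simp only [Nat.cast_ofNat]
  rw [h2] at h1
  exact h1.trans (natCard_selmerGroup_two_layer_mono W ht κ hn)

omit [W.IsGloballyMinimal] in
/-- ★ **In Mordell–Weil currency: `2^{rank W(ℚ) + rank W⁽²⁾(ℚ)} ≤ #Sel^(2)(E/ℚ_n)` for every `n ≥ 1`** (corank `= rank + corank Ш ≥ rank`,
tree `selmerCorank_eq_mordellWeilRank_add_holds`, for `W` and for its twist). [cite: DokchitserDokchitserAnnals2010, Lemma 4.14]
[cite: GreenbergLNM1716, §1 p. 53] -/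
theorem two_pow_rank_add_rank_twist_le_natCard_selmerGroup_layer (ht : ∀ x : ℚ, ¬ HasRationalTwoTorsionX W x)
    {κ : ZpExtension ℚ 2} (hκ : κ.IsCyclotomic) {n : ℕ} (hn : 1 ≤ n) :
    2 ^ (W.mordellWeilRank + (W.quadraticTwist 2).mordellWeilRank) ≤ Nat.card ((W.baseChange (κ.layer n)).selmerGroup 2) := by
  haveI : (W.quadraticTwist 2).IsElliptic := W.isElliptic_quadraticTwist (by norm_num)
  have hW := W.selmerCorank_eq_mordellWeilRank_add_holds 2
  have hT := (W.quadraticTwist 2).selmerCorank_eq_mordellWeilRank_add_holds 2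
  refine le_trans (Nat.pow_le_pow_right two_pos ?_) (two_pow_selmerCorank_add_twist_le_natCard_selmerGroup_layer W ht hκ hn)
  rw [hW, hT]; omega

omit [W.IsGloballyMinimal] in
/-- ★★ **THE PRICE OF STATIONARITY.** If at some layer `n ≥ 1` of the cyclotomic `ℤ₂`-tower the `2`-Selmer group has NOT grown,
`#Sel^(2)(E/ℚ_n) ≤ #Sel^(2)(E/ℚ)`, then `2^{corank Sel_{2^∞}(W/ℚ) + corank Sel_{2^∞}(W⁽²⁾/ℚ)} ≤ #Sel^(2)(E/ℚ)` — the twist's corank must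
already fit inside the `2`-descent over `ℚ`. [cite: DokchitserDokchitserAnnals2010, Lemma 4.14] [cite: SilvermanAEC2009, Thm. X.4.2] -/
theorem selmerCorank_add_twist_le_of_stationary (ht : ∀ x : ℚ, ¬ HasRationalTwoTorsionX W x)
    {κ : ZpExtension ℚ 2} (hκ : κ.IsCyclotomic) {n : ℕ} (hn : 1 ≤ n)
    (hstat : Nat.card ((W.baseChange (κ.layer n)).selmerGroup 2) ≤ Nat.card (W.selmerGroup 2)) :
    2 ^ (W.selmerCorank 2 + (W.quadraticTwist 2).selmerCorank 2) ≤ Nat.card (W.selmerGroup 2) :=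
  (two_pow_selmerCorank_add_twist_le_natCard_selmerGroup_layer W ht hκ hn).trans hstat

omit [W.IsGloballyMinimal] in
/-- **The price in rank `0`: `2^{corank Sel_{2^∞}(W/ℚ) + corank Sel_{2^∞}(W⁽²⁾/ℚ)} ≤ #Ш(E/ℚ)[2]`** under stationarity at a layer `n ≥ 1`
(`#Sel^(2)(E/ℚ) = #Ш(E/ℚ)[2]` when `rank E(ℚ) = 0`, Literature `natCard_selmerGroup_two_eq_natCard_sha_of_rank_zero`).
[cite: DokchitserDokchitserAnnals2010, Lemma 4.14] [cite: SilvermanAEC2009, Thm. X.4.2] -/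
theorem selmerCorank_add_twist_le_natCard_sha_of_stationary (ht : ∀ x : ℚ, ¬ HasRationalTwoTorsionX W x)
    (hr : W.mordellWeilRank = 0) {κ : ZpExtension ℚ 2} (hκ : κ.IsCyclotomic) {n : ℕ} (hn : 1 ≤ n)
    (hstat : Nat.card ((W.baseChange (κ.layer n)).selmerGroup 2) ≤ Nat.card (W.selmerGroup 2)) :
    2 ^ (W.selmerCorank 2 + (W.quadraticTwist 2).selmerCorank 2) ≤ Nat.card ((↥W.sha)[(2 : ℤ)]) := by
  have h := selmerCorank_add_twist_le_of_stationary W ht hκ hn hstat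
  rwa [natCard_selmerGroup_two_eq_natCard_torsionBy_selmerLayer_zero W ht κ,
    natCard_torsionBy_selmerLayer_zero_two_eq_natCard_sha W hr κ] at h

omit [W.IsGloballyMinimal] in
/-- ★★ **Stationarity on a seed with trivial `2`-descent forces the twist's `2^∞`-Selmer corank to vanish**: if `#Sel^(2)(E/ℚ) = 1` and
the `2`-Selmer group has not grown at some layer `n ≥ 1`, then `corank Sel_{2^∞}(W⁽²⁾/ℚ) = 0` and `corank Sel_{2^∞}(W/ℚ) = 0` (so
`rank W⁽²⁾(ℚ) = 0`). The ℚ(ζ₁₆)⁺ stationarity door of `…DescentGrowthBudget` is therefore aimed at seeds whose `ℚ(√2)`-twist has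
corank `0`; where the twist has positive corank, use the growth-budget door at `ℚ(ζ₃₂)⁺`. [cite: DokchitserDokchitserAnnals2010, Lemma 4.14]
[cite: SilvermanAEC2009, Thm. X.4.2] -/
theorem selmerCorank_twist_eq_zero_of_stationary_of_natCard_selmerGroup_eq_one (ht : ∀ x : ℚ, ¬ HasRationalTwoTorsionX W x)
    {κ : ZpExtension ℚ 2} (hκ : κ.IsCyclotomic) {n : ℕ} (hn : 1 ≤ n)
    (hstat : Nat.card ((W.baseChange (κ.layer n)).selmerGroup 2) ≤ Nat.card (W.selmerGroup 2))
    (h1 : Nat.card (W.selmerGroup 2) = 1) :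
    (W.quadraticTwist 2).selmerCorank 2 = 0 ∧ W.selmerCorank 2 = 0 := by
  have h := selmerCorank_add_twist_le_of_stationary W ht hκ hn hstat
  rw [h1] at h
  have hzero : W.selmerCorank 2 + (W.quadraticTwist 2).selmerCorank 2 = 0 := by
    by_contra hne
    have : 2 ^ 1 ≤ 2 ^ (W.selmerCorank 2 + (W.quadraticTwist 2).selmerCorank 2) :=
      Nat.pow_le_pow_right two_pos (by omega)
    omega
  omega

omit [W.IsGloballyMinimal] in
/-- The Mordell–Weil reading of the previous statement: stationarity at a layer `n ≥ 1` on a seed with `#Sel^(2)(E/ℚ) = 1` forces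
`rank W⁽²⁾(ℚ) = 0` (and `rank W(ℚ) = 0`). [cite: DokchitserDokchitserAnnals2010, Lemma 4.14] [cite: GreenbergLNM1716, §1 p. 53] -/
theorem rank_twist_eq_zero_of_stationary_of_natCard_selmerGroup_eq_one (ht : ∀ x : ℚ, ¬ HasRationalTwoTorsionX W x)
    {κ : ZpExtension ℚ 2} (hκ : κ.IsCyclotomic) {n : ℕ} (hn : 1 ≤ n)
    (hstat : Nat.card ((W.baseChange (κ.layer n)).selmerGroup 2) ≤ Nat.card (W.selmerGroup 2))
    (h1 : Nat.card (W.selmerGroup 2) = 1) :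
    (W.quadraticTwist 2).mordellWeilRank = 0 ∧ W.mordellWeilRank = 0 := by
  have h := two_pow_rank_add_rank_twist_le_natCard_selmerGroup_layer W ht hκ hn
  have h' := h.trans (hstat.trans h1.le)
  have hzero : W.mordellWeilRank + (W.quadraticTwist 2).mordellWeilRank = 0 := by
    by_contra hne
    have : 2 ^ 1 ≤ 2 ^ (W.mordellWeilRank + (W.quadraticTwist 2).mordellWeilRank) := Nat.pow_le_pow_right two_pos (by omega)
    omega
  omega

end Summit.BirchSwinnertonDyer.BirchSwinnertonDyer.Theorems.AlignedTransportAtTwoSelmerLayerDescentTwistObstruction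

end
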